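import Summits.Ventures.DiscreteObjects.Hadamard.Order49Structure668
import Summits.Ventures.DiscreteObjects.Hadamard.CompositeOrderTable

/-!
# Hadamard 668 census, family F12 — structure of (hypothetical) automorphisms of order 143 and 91 of an H(668)
# (kernel; the free-orbit bound for cyclic groups of order `p·q`)

Framing: lottery ticket; floor = certified bounds/negative ranges.

Cell pub-namedobj (venture DiscreteObjects), target (H), hadamard gen 17.  `CompositeOrderTable` (gen 11) left the
products `15, 21, 33, 35, 39, 55, 65, 69, 77, 91, 111, 123, 143` open 'by counting'.  The free-orbit bound of gen 17
(`cyclic_free_orbit_bound`: a row of `π`-period `N` forces `N·#Fix(κ) ≤ n`) sharpens the two largest products with a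
factor `13` to a UNIQUE structure (no exclusion):
* `free_of_moved_two_primes`: `κ^(pq) = 1`, `κ^p y ≠ y`, `κ^q y ≠ y` (`p, q` prime) ⇒ `y` has `κ`-period exactly `pq`;
  `fixed_of_fixed_pow_two_primes`: `κ^p y = y`, `κ^q y = y` ⇒ `κ y = y` (Bezout), so `#(Fix κ^p ∩ Fix κ^q) ≤ #Fix κ`.
* **`hadamard668_order143_structure`**: `π^143 = κ^143 = 1` with nontrivial `11`- and `13`-parts ⇒ the `11`-parts
  `π^13`, `κ^13` fix EXACTLY `52` rows / columns and NO row or column is fixed by both parts [`13`-part fixes `44`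
  (`hadamard668_signedAut_fixedRows`), `11`-part `8/30/52` (`census11`); `counting_cols`: `44 = 11a + f'`,
  `f₁₁ = 13b + f'`; a row outside `Fix(π^11) ∪ Fix(π^13)` (at most `96` rows) is free, so `143·f' ≤ 668`, `f' ≤ 4`,
  hence `f' = 0` and `13 ∣ f₁₁`, `f₁₁ = 52`].
* **`hadamard668_order91_structure`**: `π^91 = κ^91 = 1` with nontrivial `7`- and `13`-parts ⇒ the `7`-parts fix
  EXACTLY `80` rows / columns and exactly `2` rows / `2` columns are fixed by both parts [`44 = 7a + f'`, `f₇ = 13b + f'`,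
  `91·f' ≤ 668` ⇒ `f' = 2`, `f₇ = 80`].
Ours, not literature; no `sorry`.
-/

namespace Summit.Ventures.DiscreteObjects.Hadamard

open Finset BigOperators Matrix

open Literature.Combinatorics.Designs.GoethalsSeidel (IsHadamardMatrix)

variable {ι : Type*} [Fintype ι] [DecidableEq ι]

omit [Fintype ι] [DecidableEq ι] in
/-- **period exactly `pq`**: a point moved by `κ^p` and by `κ^q` (`κ^(pq) = 1`, `p ≠ q` primes) is free for `κ` below `pq`. -/
lemma free_of_moved_two_primes (κ : Equiv.Perm ι) {p q : ℕ} (hp : p.Prime) (hq : q.Prime)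
    (hκ : κ ^ (p * q) = 1) {y : ι} (hyp : (κ ^ p) y ≠ y) (hyq : (κ ^ q) y ≠ y) :
    ∀ j, 0 < j → j < p * q → (κ ^ j) y ≠ y := by
  intro j hj0 hj hfix
  have h1 : Function.IsPeriodicPt κ j y := by
    show (⇑κ)^[j] y = y
    rw [Equiv.Perm.iterate_eq_pow]; exact hfix
  have h2 : Function.IsPeriodicPt κ (p * q) y := by
    show (⇑κ)^[p * q] y = y
    rw [Equiv.Perm.iterate_eq_pow, hκ]; rfl
  have h3 := h1.gcd h2
  set g := j.gcd (p * q) with hg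
  have hgdvd : g ∣ p * q := Nat.gcd_dvd_right j (p * q)
  have hgj : g ∣ j := Nat.gcd_dvd_left j (p * q)
  have hper : ∀ m : ℕ, Function.IsPeriodicPt κ (g * m) y := fun m => h3.mul_const m
  have toFix : ∀ n : ℕ, Function.IsPeriodicPt κ n y → (κ ^ n) y = y := by
    intro n hn
    have h6 : (⇑κ)^[n] y = y := hn
    rw [Equiv.Perm.iterate_eq_pow] at h6
    exact h6
  by_cases hpg : p ∣ g
  · obtain ⟨g', hg'⟩ := hpg
    have hg'q : g' ∣ q := by
      have : p * g' ∣ p * q := hg' ▸ hgdvd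
      exact Nat.dvd_of_mul_dvd_mul_left hp.pos this
    rcases (Nat.dvd_prime hq).1 hg'q with h | h
    · -- g = p
      rw [h, mul_one] at hg'
      exact hyp (toFix p (by have := hper 1; rw [mul_one, hg'] at this; exact this))
    · -- g = p q > j
      rw [h] at hg'
      have : p * q ≤ j := by rw [← hg']; exact Nat.le_of_dvd hj0 hgj
      omega
  · have hcop : Nat.Coprime p g := (Nat.Prime.coprime_iff_not_dvd hp).2 hpg
    have hgdvd' : g ∣ q * p := by rw [mul_comm]; exact hgdvd
    have hgq : g ∣ q := hcop.symm.dvd_of_dvd_mul_right hgdvd'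
    rcases (Nat.dvd_prime hq).1 hgq with h | h
    · -- g = 1: κ y = y, hence κ^p y = y
      have hκy : κ y = y := by
        have := toFix 1 (by have := hper 1; rw [mul_one, h] at this; exact this)
        simpa using this
      exact hyp (perm_pow_apply_of_fixed κ hκy p)
    · exact hyq (toFix q (by have := hper 1; rw [mul_one, h] at this; exact this))

omit [Fintype ι] [DecidableEq ι] in
/-- **Bezout**: a point fixed by `κ^p` and `κ^q` (`p ≠ q` primes) is fixed by `κ`. -/
lemma fixed_of_fixed_pow_two_primes (κ : Equiv.Perm ι) {p q : ℕ} (hp : p.Prime) (hq : q.Prime) (hpq : p ≠ q)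
    {y : ι} (hyp : (κ ^ p) y = y) (hyq : (κ ^ q) y = y) : κ y = y := by
  have hcop : Nat.Coprime p q := (Nat.coprime_primes hp hq).2 hpq
  obtain ⟨u, -, hu⟩ := Nat.exists_mul_mod_eq_one_of_coprime hcop hq.one_lt
  -- p u = q v + 1
  have hdm := Nat.div_add_mod (p * u) q
  rw [hu] at hdm
  have h1 : (κ ^ (p * u)) y = y := by rw [pow_mul]; exact perm_pow_apply_of_fixed _ hyp u
  have h2 : (κ ^ (q * ((p * u) / q))) y = y := by rw [pow_mul]; exact perm_pow_apply_of_fixed _ hyq _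
  rw [← hdm, pow_succ, Equiv.Perm.mul_apply] at h1
  -- h1 : (κ ^ (q * (p*u/q))) (κ y) = y
  have h3 : (κ ^ (q * (p * u / q))) (κ y) = (κ ^ (q * (p * u / q))) y := by rw [h1, h2]
  exact (κ ^ (q * (p * u / q))).injective h3

/-- hence `#(Fix κ^q ∩ Fix κ^p) ≤ #Fix κ` -/
lemma card_fixed_two_pow_le (κ : Equiv.Perm ι) {p q : ℕ} (hp : p.Prime) (hq : q.Prime) (hpq : p ≠ q) :
    (univ.filter fun j => (κ ^ q) j = j ∧ (κ ^ p) j = j).card ≤ (univ.filter fun j => κ j = j).card := by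
  apply Finset.card_le_card
  intro j hj
  simp only [Finset.mem_filter, Finset.mem_univ, true_and] at hj ⊢
  exact fixed_of_fixed_pow_two_primes κ hp hq hpq hj.2 hj.1

section composite
variable {H : Matrix ι ι ℤ}

/-- the free-orbit bound for an automorphism of order `p·q` of an H(668): if at most `667` rows are fixed by `π^p` or
by `π^q`, then `p q · #(Fix κ^q ∩ Fix κ^p) ≤ 668` -/
lemma composite_fixed_bound (hH : IsHadamardMatrix H) (hι : Fintype.card ι = 668)
    {π κ : Equiv.Perm ι} {d e : ι → ℤ} (haut : IsSignedAut H π κ d e) {p q : ℕ} (hp : p.Prime) (hq : q.Prime)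
    (hpq : p ≠ q) (hodd : Odd (p * q)) (hπ : π ^ (p * q) = 1) (hκ : κ ^ (p * q) = 1)
    (hrows : (univ.filter fun i => (π ^ p) i = i).card + (univ.filter fun i => (π ^ q) i = i).card < 668) :
    p * q * (univ.filter fun j => (κ ^ q) j = j ∧ (κ ^ p) j = j).card ≤ 668 := by
  classical
  -- a row moved by π^p and by π^q
  have hex : ∃ x, (π ^ p) x ≠ x ∧ (π ^ q) x ≠ x := by
    by_contra hno
    have hall : ∀ x, (π ^ p) x = x ∨ (π ^ q) x = x := by
      intro x; by_contra h; rw [not_or] at h; exact hno ⟨x, h.1, h.2⟩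
    have hsub : (univ : Finset ι) ⊆ (univ.filter fun i => (π ^ p) i = i) ∪ (univ.filter fun i => (π ^ q) i = i) := by
      intro x _
      rcases hall x with h | h
      · exact Finset.mem_union_left _ (by simp [h])
      · exact Finset.mem_union_right _ (by simp [h])
    have h1 := (Finset.card_le_card hsub).trans (Finset.card_union_le _ _)
    rw [Finset.card_univ, hι] at h1
    omega
  obtain ⟨x₁, hx₁p, hx₁q⟩ := hex
  have hfree := free_of_moved_two_primes π hp hq hπ hx₁p hx₁q
  have hb := cyclic_free_orbit_bound hH haut hodd hπ hκ x₁ hfree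
  rw [hι] at hb
  have hle := card_fixed_two_pow_le κ hp hq hpq
  calc p * q * (univ.filter fun j => (κ ^ q) j = j ∧ (κ ^ p) j = j).card
      ≤ p * q * (univ.filter fun j => κ j = j).card := Nat.mul_le_mul_left _ hle
    _ ≤ 668 := hb

/-- nontriviality of the row part of a power from nontriviality of the pair (odd exponent) -/
lemma fst_pow_ne_one (hH : IsHadamardMatrix H) (hcard : (Fintype.card ι : ℤ) ≠ 0)
    {π κ : Equiv.Perm ι} {d e : ι → ℤ} (haut : IsSignedAut H π κ d e) {a m : ℕ} (hodd : Odd m)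
    (hκm : (κ ^ a) ^ m = 1) (hne : π ^ a ≠ 1 ∨ κ ^ a ≠ 1) : π ^ a ≠ 1 := by
  rcases hne with h | h
  · exact h
  · intro h1; apply h
    have ha := isSignedAut_pow haut a
    rw [h1] at ha
    exact signedAut_snd_eq_one H hH hcard ha hodd hκm

/-- **order 143 = 11·13**: the `11`-parts fix exactly `52` rows / columns and no row / column is fixed by both parts. -/
theorem hadamard668_order143_structure (hH : IsHadamardMatrix H) (hι : Fintype.card ι = 668)
    (π κ : Equiv.Perm ι) (d e : ι → ℤ) (haut : IsSignedAut H π κ d e)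
    (hπ : π ^ (11 * 13) = 1) (hκ : κ ^ (11 * 13) = 1)
    (h13 : π ^ 13 ≠ 1 ∨ κ ^ 13 ≠ 1) (h11 : π ^ 11 ≠ 1 ∨ κ ^ 11 ≠ 1) :
    (univ.filter fun i => (π ^ 13) i = i).card = 52 ∧ (univ.filter fun j => (κ ^ 13) j = j).card = 52 ∧
    (univ.filter fun i => (π ^ 13) i = i ∧ (π ^ 11) i = i).card = 0 ∧
    (univ.filter fun j => (κ ^ 13) j = j ∧ (κ ^ 11) j = j).card = 0 := by
  have hcard : (Fintype.card ι : ℤ) ≠ 0 := by rw [hι]; norm_num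
  have hHt : IsHadamardMatrix Hᵀ := isHadamard_transpose hH hcard
  have hautT := isSignedAut_transpose haut
  -- the two parts
  have hπ13 : (π ^ 13) ^ 11 = 1 := by rw [← pow_mul]; exact hπ
  have hκ13 : (κ ^ 13) ^ 11 = 1 := by rw [← pow_mul]; exact hκ
  have hπ11 : (π ^ 11) ^ 13 = 1 := by rw [← pow_mul]; exact hπ
  have hκ11 : (κ ^ 11) ^ 13 = 1 := by rw [← pow_mul]; exact hκ
  have hne13 : π ^ 13 ≠ 1 := fst_pow_ne_one hH hcard haut (by decide : Odd 11) hκ13 h13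
  -- census of the 11-part and the 13-part
  obtain ⟨cC, cR⟩ := census11 hH hι (isSignedAut_pow haut 13) hπ13 hκ13 hne13
  obtain ⟨eRC, h44⟩ := hadamard668_signedAut_fixedRows hH hι 13 (by norm_num) (by norm_num) (π ^ 11) (κ ^ 11) _ _
    (isSignedAut_pow haut 11) hπ11 hκ11 h11
  have h44R : (univ.filter fun i => (π ^ 11) i = i).card = 44 := by
    rcases h44 with ⟨-, h⟩ | ⟨h, -⟩ | ⟨h, -⟩ | ⟨h, -⟩ | ⟨h, -⟩ | ⟨h, -⟩ <;> first | exact h | norm_num at h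
  have h44C : (univ.filter fun j => (κ ^ 11) j = j).card = 44 := by rw [← eRC]; exact h44R
  -- counting on columns and rows
  obtain ⟨c1, ⟨a, ha⟩, c2, ⟨b, hb⟩, -, -⟩ := counting_cols κ (by norm_num : (11 : ℕ).Prime) (by norm_num : (13 : ℕ).Prime) hκ
  obtain ⟨r1, ⟨a', ha'⟩, r2, ⟨b', hb'⟩, -, -⟩ := counting_cols π (by norm_num : (11 : ℕ).Prime) (by norm_num : (13 : ℕ).Prime) hπ
  -- free-orbit bounds (columns and rows)
  have hbC := composite_fixed_bound hH hι haut (by norm_num : (11 : ℕ).Prime) (by norm_num : (13 : ℕ).Prime) (by norm_num)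
    (by decide : Odd (11 * 13)) hπ hκ (by rcases cR with h | h | h <;> omega)
  have hbR := composite_fixed_bound hHt hι hautT (by norm_num : (11 : ℕ).Prime) (by norm_num : (13 : ℕ).Prime) (by norm_num)
    (by decide : Odd (11 * 13)) hκ hπ (by rcases cC with h | h | h <;> omega)
  refine ⟨?_, ?_, ?_, ?_⟩
  · rcases cR with h | h | h <;> omega
  · rcases cC with h | h | h <;> omega
  · omega
  · omega

/-- **order 91 = 7·13**: the `7`-parts fix exactly `80` rows / columns and exactly `2` rows / `2` columns are fixed by
both parts. -/
theorem hadamard668_order91_structure (hH : IsHadamardMatrix H) (hι : Fintype.card ι = 668)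
    (π κ : Equiv.Perm ι) (d e : ι → ℤ) (haut : IsSignedAut H π κ d e)
    (hπ : π ^ (7 * 13) = 1) (hκ : κ ^ (7 * 13) = 1)
    (h13 : π ^ 13 ≠ 1 ∨ κ ^ 13 ≠ 1) (h7 : π ^ 7 ≠ 1 ∨ κ ^ 7 ≠ 1) :
    (univ.filter fun i => (π ^ 13) i = i).card = 80 ∧ (univ.filter fun j => (κ ^ 13) j = j).card = 80 ∧
    (univ.filter fun i => (π ^ 13) i = i ∧ (π ^ 7) i = i).card = 2 ∧
    (univ.filter fun j => (κ ^ 13) j = j ∧ (κ ^ 7) j = j).card = 2 := by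
  have hcard : (Fintype.card ι : ℤ) ≠ 0 := by rw [hι]; norm_num
  have hHt : IsHadamardMatrix Hᵀ := isHadamard_transpose hH hcard
  have hautT := isSignedAut_transpose haut
  have hπ13 : (π ^ 13) ^ 7 = 1 := by rw [← pow_mul]; exact hπ
  have hκ13 : (κ ^ 13) ^ 7 = 1 := by rw [← pow_mul]; exact hκ
  have hπ7 : (π ^ 7) ^ 13 = 1 := by rw [← pow_mul]; exact hπ
  have hκ7 : (κ ^ 7) ^ 13 = 1 := by rw [← pow_mul]; exact hκ
  have hne13 : π ^ 13 ≠ 1 := fst_pow_ne_one hH hcard haut (by decide : Odd 7) hκ13 h13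
  obtain ⟨cC, cR⟩ := census7 hH hι (isSignedAut_pow haut 13) hπ13 hκ13 hne13
  obtain ⟨eRC, h44⟩ := hadamard668_signedAut_fixedRows hH hι 13 (by norm_num) (by norm_num) (π ^ 7) (κ ^ 7) _ _
    (isSignedAut_pow haut 7) hπ7 hκ7 h7
  have h44R : (univ.filter fun i => (π ^ 7) i = i).card = 44 := by
    rcases h44 with ⟨-, h⟩ | ⟨h, -⟩ | ⟨h, -⟩ | ⟨h, -⟩ | ⟨h, -⟩ | ⟨h, -⟩ <;> first | exact h | norm_num at h
  have h44C : (univ.filter fun j => (κ ^ 7) j = j).card = 44 := by rw [← eRC]; exact h44R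
  obtain ⟨c1, ⟨a, ha⟩, c2, ⟨b, hb⟩, -, -⟩ := counting_cols κ (by norm_num : (7 : ℕ).Prime) (by norm_num : (13 : ℕ).Prime) hκ
  obtain ⟨r1, ⟨a', ha'⟩, r2, ⟨b', hb'⟩, -, -⟩ := counting_cols π (by norm_num : (7 : ℕ).Prime) (by norm_num : (13 : ℕ).Prime) hπ
  have hbC := composite_fixed_bound hH hι haut (by norm_num : (7 : ℕ).Prime) (by norm_num : (13 : ℕ).Prime) (by norm_num)
    (by decide : Odd (7 * 13)) hπ hκ (by rcases cR with h | h | h | h | h <;> omega)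
  have hbR := composite_fixed_bound hHt hι hautT (by norm_num : (7 : ℕ).Prime) (by norm_num : (13 : ℕ).Prime) (by norm_num)
    (by decide : Odd (7 * 13)) hκ hπ (by rcases cC with h | h | h | h | h <;> omega)
  refine ⟨?_, ?_, ?_, ?_⟩
  · rcases cR with h | h | h | h | h <;> omega
  · rcases cC with h | h | h | h | h <;> omega
  · rcases cR with h | h | h | h | h <;> omega
  · rcases cC with h | h | h | h | h <;> omega

end composite

end Summit.Ventures.DiscreteObjects.Hadamard
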